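import Mathlib.MeasureTheory.Integral.MeanInequalities
import Mathlib.MeasureTheory.Integral.Lebesgue.Markov
import Mathlib.MeasureTheory.Measure.Typeclasses.Probability
import HarnessLib

/-!
# The Paley–Zygmund inequality (second moment method), `ℝ≥0∞`-valued form

Topic: probability / moments. For an a.e.-measurable `f : Ω → ℝ≥0∞` on a probability space and
any level `a`,

`(E f - a)² ≤ E[f²] · P(a < f)` (`paleyZygmund`), i.e. `P(a < f) ≥ (E f - a)² / E[f²]`
(`paleyZygmund_div_le`);

with `a = θ E f` this is the classical Paley–Zygmund inequality `P(f > θ E f) ≥ (1-θ)² (E f)²/E f²`.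
Proof: `E f ≤ a + E[f; a < f]` pointwise, and Cauchy–Schwarz (Mathlib's Hölder inequality
`ENNReal.lintegral_mul_le_Lp_mul_Lq` with `p = q = 2`) for the second term
(`sq_setLIntegral_le_lintegral_sq_mul_measure`). The `ℝ≥0∞` form needs no integrability
hypotheses (truncated subtraction; the bound is trivial when `E f = ∞`).

## Mathlib

We USE `ENNReal.lintegral_mul_le_Lp_mul_Lq`, `Real.HolderConjugate.two_two`,
`lintegral_indicator₀`, `lintegral_add_left'`. Mathlib has Markov/Chebyshev
(`meas_ge_le_lintegral_div`, `meas_ge_le_variance_div_sq`) but no Paley–Zygmund inequality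
(searched `Paley`, `Zygmund`, `second moment`).

## References

* R. E. A. C. Paley, A. Zygmund, *A note on analytic functions in the unit circle*, Proc. Camb.
  Phil. Soc. 28 (1932) 266–272.
* J.-P. Kahane, *Some Random Series of Functions*, 2nd ed., CUP (1985), Ch. I §6, Inequality II.
-/

noncomputable section

open Set Filter Function
open _root_.MeasureTheory
open scoped ENNReal NNReal

namespace Literature.Probability.Moments

variable {Ω : Type*} {mΩ : MeasurableSpace Ω} {P : Measure Ω}

/-- **Cauchy–Schwarz for the tail part**: `∫ f · 1{a < f} ≤ √(∫ f²) · √(P{a < f})`, in the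
squared form `(∫⁻ ω in {a < f}, f)² ≤ (∫⁻ f²) · P {a < f}` (Hölder with `p = q = 2`,
Mathlib `ENNReal.lintegral_mul_le_Lp_mul_Lq`). [folklore] -/
theorem sq_setLIntegral_le_lintegral_sq_mul_measure {f : Ω → ℝ≥0∞} (hf : AEMeasurable f P)
    (a : ℝ≥0∞) :
    (∫⁻ ω in {ω | a < f ω}, f ω ∂P) ^ 2 ≤ (∫⁻ ω, f ω ^ 2 ∂P) * P {ω | a < f ω} := by
  have hA : NullMeasurableSet {ω | a < f ω} P :=
    nullMeasurableSet_lt aemeasurable_const hf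
  -- write the restricted integral as `∫ f · g` with `g` the indicator
  set g : Ω → ℝ≥0∞ := {ω | a < f ω}.indicator 1 with hg
  have hgm : AEMeasurable g P := (aemeasurable_indicator_iff₀ hA).2 aemeasurable_const
  have hfg : ∫⁻ ω in {ω | a < f ω}, f ω ∂P = ∫⁻ ω, f ω * g ω ∂P := by
    rw [← lintegral_indicator₀ hA]
    congr 1
    funext ω
    simp only [hg, indicator, Pi.one_apply]
    split_ifs <;> simp
  have hg2 : ∫⁻ ω, g ω ^ (2 : ℝ) ∂P = P {ω | a < f ω} := by
    have : (fun ω ↦ g ω ^ (2 : ℝ)) = g := by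
      funext ω
      simp only [hg, indicator, Pi.one_apply]
      split_ifs <;> simp
    rw [this, hg, lintegral_indicator_one₀ hA]
  have hpq : Real.HolderConjugate 2 2 := Real.HolderConjugate.two_two
  have hH := ENNReal.lintegral_mul_le_Lp_mul_Lq P hpq hf hgm
  rw [hfg]
  calc (∫⁻ ω, f ω * g ω ∂P) ^ 2
      ≤ ((∫⁻ ω, f ω ^ (2 : ℝ) ∂P) ^ (1 / (2 : ℝ)) * (∫⁻ ω, g ω ^ (2 : ℝ) ∂P) ^ (1 / (2 : ℝ))) ^ 2 := by
        gcongr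
        simpa using hH
    _ = (∫⁻ ω, f ω ^ (2 : ℝ) ∂P) * (∫⁻ ω, g ω ^ (2 : ℝ) ∂P) := by
        rw [mul_pow, ← ENNReal.rpow_natCast, ← ENNReal.rpow_natCast, ← ENNReal.rpow_mul,
          ← ENNReal.rpow_mul]
        norm_num
    _ = (∫⁻ ω, f ω ^ 2 ∂P) * P {ω | a < f ω} := by
        rw [hg2]
        congr 1
        refine lintegral_congr fun ω ↦ ?_
        rw [← ENNReal.rpow_natCast]
        norm_num

/-- **Paley–Zygmund inequality** (`ℝ≥0∞` form, for an a.e.-measurable `f ≥ 0` on a probability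
space): for every level `a`,
`(E f - a)² ≤ E[f²] · P(a < f)`
(`E f ≤ a + E[f; a < f]` and Cauchy–Schwarz). With `a = θ E f` this is the classical
`P(f > θ E f) ≥ (1 - θ)² (E f)² / E[f²]`. Paley–Zygmund (1932); Kahane, *Some random series of
functions*, 2nd ed. (1985), Ch. I §6, Inequality II. [folklore] -/
theorem paleyZygmund [IsProbabilityMeasure P] {f : Ω → ℝ≥0∞} (hf : AEMeasurable f P)
    (a : ℝ≥0∞) :
    (∫⁻ ω, f ω ∂P - a) ^ 2 ≤ (∫⁻ ω, f ω ^ 2 ∂P) * P {ω | a < f ω} := by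
  have hA : NullMeasurableSet {ω | a < f ω} P :=
    nullMeasurableSet_lt aemeasurable_const hf
  -- `E f ≤ a + ∫_{a < f} f`, from the pointwise `f ≤ a + f · 1{a < f}`
  have hpt : ∀ ω, f ω ≤ a + {ω | a < f ω}.indicator f ω := fun ω ↦ by
    by_cases h : a < f ω
    · rw [indicator_of_mem (show ω ∈ {ω | a < f ω} from h)]
      exact le_add_self
    · rw [not_lt] at h
      exact h.trans le_self_add
  have hsplit : ∫⁻ ω, f ω ∂P ≤ a + ∫⁻ ω in {ω | a < f ω}, f ω ∂P := by
    calc ∫⁻ ω, f ω ∂P ≤ ∫⁻ ω, a + {ω | a < f ω}.indicator f ω ∂P := lintegral_mono hpt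
      _ = a + ∫⁻ ω in {ω | a < f ω}, f ω ∂P := by
        rw [lintegral_add_left' aemeasurable_const, lintegral_const, measure_univ, mul_one,
          lintegral_indicator₀ hA]
  calc (∫⁻ ω, f ω ∂P - a) ^ 2 ≤ (∫⁻ ω in {ω | a < f ω}, f ω ∂P) ^ 2 := by
        gcongr
        exact tsub_le_iff_left.2 hsplit
    _ ≤ (∫⁻ ω, f ω ^ 2 ∂P) * P {ω | a < f ω} :=
        sq_setLIntegral_le_lintegral_sq_mul_measure hf a

/-- **Paley–Zygmund, probability lower bound**: `P(a < f) ≥ (E f - a)² / E[f²]`. [folklore] -/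
theorem paleyZygmund_div_le [IsProbabilityMeasure P] {f : Ω → ℝ≥0∞} (hf : AEMeasurable f P)
    (a : ℝ≥0∞) :
    (∫⁻ ω, f ω ∂P - a) ^ 2 / (∫⁻ ω, f ω ^ 2 ∂P) ≤ P {ω | a < f ω} :=
  ENNReal.div_le_of_le_mul' (paleyZygmund hf a)

end Literature.Probability.Moments

end
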